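import Literature.NumberTheory.Automorphic.UnitaryGroupDoubledSiegelGeneration
import HarnessLib

/-!
# Moving an element of the doubled unitary group into the big cell by the unipotent radical of `P_Δ`
# ([Kudla1994, §3]; [HarrisKudlaSweet1996, §1 (1.11)]; [Borel1991, §14.21])

Topic `NumberTheory/Automorphic`; namespace `Literature.NumberTheory.Automorphic.DoubledUnitary` (sequel of
`UnitaryGroupDoubledSiegelGeneration`, whose PRIVATE lemma `exists_upperUnipotent_isUnit_block₁₁` (seat carch-1)
this file restates at the matrix level and makes public; the proof below is that lemma's proof, adapted).  KERNEL only;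
no named fact, no `sorry`.

Setting: `K` any field, `σ` an involution of `K` admitting `θ ≠ 0` with `σ θ = −θ` (so `char K ≠ 2` is not even needed
beyond what `θ` gives), `τ ∈ GL_ι(K)` symmetric and `σ`-fixed, `J' = antidiag(τ, τ)` the doubled hermitian form in the
frame adapted to `𝔻 = Δ ⊕ Δ⁻`, `P` the block-upper Siegel parabolic, `N = {n⁺(y) = [[1, y], [0, 1]] : τ y + σ(y)ᵀ τ = 0}`
its unipotent radical, `Ω = {g ∣ g₁₁ invertible} = N⁻ P` the big cell.

MAIN RESULT (`exists_skew_isUnit_block₁₁_add`): **for every `g ∈ U(σ, J')(K)` there is a `τ`-skew `y`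
(`τ y + σ(y)ᵀ τ = 0`) with `g₁₁ + y g₂₁` invertible** — i.e. `n⁺(y) g ∈ Ω`: every maximal isotropic subspace `g Δ`
admits a maximal isotropic complement `n⁺(−y) Δ⁻` transversal to `Δ` as well.  Construction (carch-1): pivot
`α g₁₁ β = diag D`; `f` = indicator of `{D = 0}`, `f̃ = β f β⁻¹` (a projection onto `ker g₁₁`); `Γ` with `Γ (g₂₁ f̃) = f̃`
(exists: `g` is invertible); `W = σ(β⁻¹)ᵀ f β⁻¹`, `M = σ(Γ)ᵀ W Γ`, `y = τ⁻¹ (θ M)`; the isotropy relation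
`σ(g₂₁)ᵀ τ g₁₁ + σ(g₁₁)ᵀ τ g₂₁ = 0` gives `σ(g₂₁ f̃)ᵀ τ g₁₁ = 0`, whence
`(g₁₁ + y g₂₁) u = 0 ⇒ W Γ g₂₁ u = 0 ⇒ g₁₁ u = 0 ⇒ u = f̃ u ⇒ W u = 0 ⇒ u = 0`.

Used over the RESIDUE FIELD `𝓀[E_w]` at a good inert place (`σ̄` induced by `c`, `θ̄ = δ̄`, `τ = 2T̄₀`) in the unramified
clause of the [GelbartRogawski1991, Prop. 3.1.1] kernel construction (stage-1 cell `pub-hodgecm`, seat GR-1, brick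
L7a: `Automorphic/UnitaryGroupDoubledIntegralWitness`, `GelbartRogawski1991/LocalDoubledUnitaryResidueWitness`).

## References

* S. S. Kudla, Israel J. Math. 87 (1994) 361–401, §3 [Kudla1994].
* M. Harris, S. S. Kudla, W. J. Sweet, J. Amer. Math. Soc. 9 (1996) 941–1004, §1 (1.11) [HarrisKudlaSweet1996].
* A. Borel, *Linear Algebraic Groups*, 2nd ed., GTM 126 (1991), §14.21 (the big cell) [Borel1991].
-/

set_option autoImplicit false

noncomputable section

open scoped Matrix MatrixGroups
open Matrix

namespace Literature.NumberTheory.Automorphic.DoubledUnitary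

variable {K : Type*} [Field K] {ι : Type*} [Fintype ι] [DecidableEq ι] (σ : K →+* K)

/-! ## §1 Linear-algebra helpers (restated from the private part of `UnitaryGroupDoubledSiegelGeneration`) -/

omit [DecidableEq ι] in
/-- Row-space factorisation over a field: if every column vector killed by `A` is killed by `B`, then `B = Γ A`
for some square `Γ` (descend `B` to `range A ≅ V ⧸ ker A` and extend to `V`). [folklore] -/
private theorem exists_mul_eq_of_mulVec_eq_zero' [DecidableEq ι] (A B : Matrix ι ι K)
    (h : ∀ v, A *ᵥ v = 0 → B *ᵥ v = 0) : ∃ Γ : Matrix ι ι K, Γ * A = B := by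
  let fA := Matrix.toLin' A
  let fB := Matrix.toLin' B
  have hker : LinearMap.ker fA ≤ LinearMap.ker fB := fun v hv => by
    simp only [LinearMap.mem_ker, fA, fB, Matrix.toLin'_apply] at hv ⊢
    exact h v hv
  let fBbar : LinearMap.range fA →ₗ[K] (ι → K) :=
    ((LinearMap.ker fA).liftQ fB hker).comp fA.quotKerEquivRange.symm.toLinearMap
  obtain ⟨Γl, hΓl⟩ := LinearMap.exists_extend fBbar
  have hcomp : Γl.comp fA = fB := by
    apply LinearMap.ext
    intro v
    have hmem : fA v ∈ LinearMap.range fA := LinearMap.mem_range_self fA v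
    have h1 : Γl (fA v) = fBbar ⟨fA v, hmem⟩ := by rw [← hΓl]; rfl
    rw [LinearMap.comp_apply, h1]
    simp only [fBbar, LinearMap.comp_apply, LinearEquiv.coe_toLinearMap,
      LinearMap.quotKerEquivRange_symm_apply_image, Submodule.mkQ_apply, Submodule.liftQ_apply]
  refine ⟨LinearMap.toMatrix' Γl, ?_⟩
  calc LinearMap.toMatrix' Γl * A = LinearMap.toMatrix' Γl * LinearMap.toMatrix' fA := by
        rw [LinearMap.toMatrix'_toLin']
    _ = LinearMap.toMatrix' (Γl.comp fA) := (LinearMap.toMatrix'_comp _ _).symm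
    _ = B := by rw [hcomp, LinearMap.toMatrix'_toLin']

omit [Fintype ι] [DecidableEq ι] in
/-- `σ(σ(X)) = X` entrywise for an involution `σ`. [folklore] -/
private theorem map_map_of_involutive (hσ : ∀ x, σ (σ x) = x) (X : Matrix ι ι K) : (X.map σ).map σ = X := by
  ext i j; simp [hσ]

omit [DecidableEq ι] in
/-- `σ(X)ᵀ F X` is `σ`-hermitian when `F` is. [folklore] -/
private theorem cstar_sandwich_hermitian (hσ : ∀ x, σ (σ x) = x) (F X : Matrix ι ι K) (hF : (F.map σ)ᵀ = F) :
    (((X.map σ)ᵀ * F * X).map σ)ᵀ = (X.map σ)ᵀ * F * X := by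
  rw [Matrix.map_mul, Matrix.map_mul, Matrix.transpose_mul, Matrix.transpose_mul, Matrix.transpose_map,
    map_map_of_involutive σ hσ, Matrix.transpose_transpose, hF, Matrix.mul_assoc]

variable {τ : Matrix ι ι K}

/-- the `(1,1)`-block equation of `σ(g)ᵀ J' g = J'`: `σ(c)ᵀ τ a + σ(a)ᵀ τ c = 0` (isotropy of `g Δ`).
[cite: HarrisKudlaSweet1996, §1 (1.11)] -/
theorem cstar_block_rel₁₁ {g : GL (ι ⊕ ι) K} (hg : g ∈ unitaryGroupOfForm σ (antidiagForm τ)) :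
    ((g : Matrix (ι ⊕ ι) (ι ⊕ ι) K).toBlocks₂₁.map σ)ᵀ * τ * (g : Matrix (ι ⊕ ι) (ι ⊕ ι) K).toBlocks₁₁ +
      ((g : Matrix (ι ⊕ ι) (ι ⊕ ι) K).toBlocks₁₁.map σ)ᵀ * τ * (g : Matrix (ι ⊕ ι) (ι ⊕ ι) K).toBlocks₂₁ = 0 := by
  rw [mem_unitaryGroupOfForm_iff] at hg
  set M := (g : Matrix (ι ⊕ ι) (ι ⊕ ι) K) with hM
  have hM' : M = Matrix.fromBlocks M.toBlocks₁₁ M.toBlocks₁₂ M.toBlocks₂₁ M.toBlocks₂₂ :=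
    (Matrix.fromBlocks_toBlocks M).symm
  rw [hM', antidiagForm, Matrix.fromBlocks_map, Matrix.fromBlocks_transpose] at hg
  simp only [Matrix.fromBlocks_multiply, Matrix.mul_zero, add_zero, zero_add] at hg
  have h11 := congrArg Matrix.toBlocks₁₁ hg
  simp only [Matrix.toBlocks_fromBlocks₁₁] at h11
  exact h11

/-! ## §2 The witness -/

/-- **Moving an element of `U(σ, antidiag(τ, τ))` into the big cell by `N`.**  For every `g ∈ U(σ, J')` there is
`y` with `τ y + σ(y)ᵀ τ = 0` (so `n⁺(y) ∈ N ⊆ P`) such that `g₁₁ + y g₂₁` (= `(n⁺(y) g)₁₁`) is invertible.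
(Matrix-level restatement of the private `exists_upperUnipotent_isUnit_block₁₁` of `UnitaryGroupDoubledSiegelGeneration`;
its proof, adapted.) [cite: Kudla1994, §3; Borel1991, §14.21] -/
theorem exists_skew_isUnit_block₁₁_add (hσ : ∀ x, σ (σ x) = x) {θ : K} (hθ : σ θ = -θ) (hθ0 : θ ≠ 0)
    (hτ : τ.map σ = τ) (hτs : τᵀ = τ) (hτu : IsUnit τ.det) {g : GL (ι ⊕ ι) K}
    (hg : g ∈ unitaryGroupOfForm σ (antidiagForm τ)) :
    ∃ y : Matrix ι ι K, τ * y + (y.map σ)ᵀ * τ = 0 ∧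
      IsUnit ((g : Matrix (ι ⊕ ι) (ι ⊕ ι) K).toBlocks₁₁ + y * (g : Matrix (ι ⊕ ι) (ι ⊕ ι) K).toBlocks₂₁) := by
  classical
  set M := (g : Matrix (ι ⊕ ι) (ι ⊕ ι) K) with hM
  set a := M.toBlocks₁₁
  set b := M.toBlocks₁₂
  set c := M.toBlocks₂₁
  set d := M.toBlocks₂₂
  have hMblk : M = Matrix.fromBlocks a b c d := (Matrix.fromBlocks_toBlocks M).symm
  have hrel : (c.map σ)ᵀ * τ * a + (a.map σ)ᵀ * τ * c = 0 := cstar_block_rel₁₁ σ hg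
  -- pivot normal form of `a`
  obtain ⟨L, L', D, hD⟩ := Matrix.Pivot.exists_list_transvec_mul_mul_list_transvec_eq_diagonal a
  set α := (L.map Matrix.TransvectionStruct.toMatrix).prod with hα
  set β := (L'.map Matrix.TransvectionStruct.toMatrix).prod with hβ
  have hαd : IsUnit α.det := by rw [hα, Matrix.TransvectionStruct.det_toMatrix_prod]; exact isUnit_one
  have hβd : IsUnit β.det := by rw [hβ, Matrix.TransvectionStruct.det_toMatrix_prod]; exact isUnit_one
  have ha : α⁻¹ * Matrix.diagonal D * β⁻¹ = a := by
    rw [← hD]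
    simp only [Matrix.mul_assoc, Matrix.mul_nonsing_inv β hβd, Matrix.mul_one]
    rw [← Matrix.mul_assoc, Matrix.nonsing_inv_mul α hαd, Matrix.one_mul]
  have hαa : α * a = Matrix.diagonal D * β⁻¹ := by
    rw [← ha]
    simp only [← Matrix.mul_assoc, Matrix.mul_nonsing_inv α hαd, Matrix.one_mul]
  -- the indicator `f` of `{D = 0}` and the projection `f̃ = β f β⁻¹` onto `ker a`
  set χ : ι → K := fun i => if D i = 0 then 1 else 0 with hχ
  set f : Matrix ι ι K := Matrix.diagonal χ with hf
  have hDf : Matrix.diagonal D * f = 0 := by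
    rw [hf, Matrix.diagonal_mul_diagonal, ← Matrix.diagonal_zero]
    congr 1; funext i
    by_cases hi : D i = 0 <;> simp [hχ, hi]
  have hff : f * f = f := by
    rw [hf, Matrix.diagonal_mul_diagonal]
    congr 1; funext i
    by_cases hi : D i = 0 <;> simp [hχ, hi]
  have hfT : fᵀ = f := Matrix.diagonal_transpose χ
  have hfσ : f.map σ = f := by
    rw [hf, Matrix.diagonal_map (map_zero σ)]
    congr 1; funext i
    by_cases hi : D i = 0 <;> simp [hχ, hi]
  set βi := β⁻¹ with hβi
  have hβid : IsUnit βi.det := Matrix.isUnit_det_of_right_inverse (Matrix.nonsing_inv_mul β hβd)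
  set ft := β * f * βi with hft
  set N := c * ft with hN
  have haft : a * ft = 0 := by
    rw [← ha, hft]
    simp only [Matrix.mul_assoc]
    rw [← Matrix.mul_assoc βi β, hβi, Matrix.nonsing_inv_mul β hβd, Matrix.one_mul, ← Matrix.mul_assoc (Matrix.diagonal D) f,
      hDf, Matrix.zero_mul, Matrix.mul_zero]
  -- `ker N ≤ ker f̃` since `g` is invertible, whence `Γ` with `Γ N = f̃`
  have hker : ∀ u, N *ᵥ u = 0 → ft *ᵥ u = 0 := by
    intro u hu
    have hinj := Matrix.mulVec_injective_iff_isUnit.2 (Units.isUnit g)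
    have h0 : M *ᵥ Sum.elim (ft *ᵥ u) 0 = M *ᵥ 0 := by
      rw [Matrix.mulVec_zero, hMblk, Matrix.fromBlocks_mulVec]
      funext i
      cases i with
      | inl i => simp [Matrix.mulVec_mulVec, haft]
      | inr i => simp [Matrix.mulVec_mulVec, ← hN, hu]
    have hv := hinj h0
    funext i
    simpa using congrFun hv (Sum.inl i)
  obtain ⟨Γ, hΓ⟩ := exists_mul_eq_of_mulVec_eq_zero' N ft hker
  -- the hermitian matrices `W`, `Mm` and the skew `y`
  set W := (βi.map σ)ᵀ * f * βi with hW
  set Mm := (Γ.map σ)ᵀ * W * Γ with hMm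
  set y := τ⁻¹ * (θ • Mm) with hy
  have hWh : (W.map σ)ᵀ = W := cstar_sandwich_hermitian σ hσ f βi (by rw [hfσ, hfT])
  have hMh : (Mm.map σ)ᵀ = Mm := cstar_sandwich_hermitian σ hσ W Γ hWh
  have hτinvσ : τ⁻¹.map σ = τ⁻¹ := by
    refine (Matrix.inv_eq_left_inv ?_).symm
    rw [show τ⁻¹.map σ * τ = τ⁻¹.map σ * τ.map σ by rw [hτ], ← Matrix.map_mul, Matrix.nonsing_inv_mul τ hτu,
      Matrix.map_one σ (map_zero σ) (map_one σ)]
  have hτy : τ * y = θ • Mm := by rw [hy, ← Matrix.mul_assoc, Matrix.mul_nonsing_inv τ hτu, Matrix.one_mul]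
  refine ⟨y, ?_, ?_⟩
  · -- skewness: `τ y = θ M` with `M` hermitian and `σ θ = -θ`
    rw [hτy, hy, Matrix.map_mul, hτinvσ, Matrix.map_smul' (σ : K → K) θ Mm (_root_.map_mul σ), hθ, Matrix.transpose_mul,
      Matrix.transpose_smul, hMh, Matrix.transpose_nonsing_inv, hτs]
    simp only [Matrix.mul_assoc, Matrix.nonsing_inv_mul τ hτu, Matrix.mul_one, neg_smul, add_neg_cancel]
  · -- the `(1,1)`-block `a + y c` has trivial kernel
    -- (LA1) `σ(N)ᵀ τ a = 0`
    have LA1 : (N.map σ)ᵀ * τ * a = 0 := by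
      have h1 : (c.map σ)ᵀ * τ * a = -((a.map σ)ᵀ * τ * c) := eq_neg_of_add_eq_zero_left hrel
      calc (N.map σ)ᵀ * τ * a = (ft.map σ)ᵀ * ((c.map σ)ᵀ * τ * a) := by
            rw [hN, Matrix.map_mul, Matrix.transpose_mul]; simp only [Matrix.mul_assoc]
        _ = -(((a * ft).map σ)ᵀ * τ * c) := by
            rw [h1, Matrix.mul_neg]
            conv_rhs => rw [Matrix.map_mul, Matrix.transpose_mul]
            simp only [Matrix.mul_assoc]
        _ = 0 := by rw [haft]; simp
    -- (LA2) `σ(f̃)ᵀ W = W`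
    have hββ : (β.map σ)ᵀ * (βi.map σ)ᵀ = 1 := by
      rw [← Matrix.transpose_mul, ← Matrix.map_mul, hβi, Matrix.nonsing_inv_mul β hβd, Matrix.map_one σ (map_zero σ) (map_one σ),
        Matrix.transpose_one]
    have LA2 : (ft.map σ)ᵀ * W = W := by
      calc (ft.map σ)ᵀ * W = (βi.map σ)ᵀ * (f * ((β.map σ)ᵀ * (βi.map σ)ᵀ) * f) * βi := by
            rw [hft, hW, Matrix.map_mul, Matrix.map_mul, hfσ, Matrix.transpose_mul, Matrix.transpose_mul, hfT]
            simp only [Matrix.mul_assoc]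
        _ = W := by rw [hββ, Matrix.mul_one, hff, hW, Matrix.mul_assoc]
    -- (LA3) `σ(N)ᵀ M = W Γ`, (LA4) `σ(N)ᵀ τ (y c) = θ (W Γ c)`
    have LA3 : (N.map σ)ᵀ * Mm = W * Γ := by
      rw [hMm, ← Matrix.mul_assoc, ← Matrix.mul_assoc, ← Matrix.transpose_mul, ← Matrix.map_mul, hΓ, LA2]
    have LA4 : (N.map σ)ᵀ * τ * (y * c) = θ • (W * Γ * c) := by
      rw [← Matrix.mul_assoc, Matrix.mul_assoc _ τ y, hτy, Matrix.mul_smul, LA3, Matrix.smul_mul]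
    -- trivial kernel
    have key : ∀ u, (a + y * c) *ᵥ u = 0 → u = 0 := by
      intro u hu
      -- Step A: `(W Γ c) u = 0`
      have hA : (W * Γ * c) *ᵥ u = 0 := by
        have h1 := congrArg (((N.map σ)ᵀ * τ).mulVec) hu
        simp only [Matrix.mulVec_zero, Matrix.add_mulVec, Matrix.mulVec_add, Matrix.mulVec_mulVec, LA1, LA4,
          Matrix.zero_mulVec, zero_add, Matrix.smul_mulVec, smul_eq_zero] at h1
        exact h1.resolve_left hθ0
      -- Step B: `y c u = 0`, hence `a u = 0`
      have hB : (y * c) *ᵥ u = 0 := by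
        have : y * c = θ • ((τ⁻¹ * (Γ.map σ)ᵀ) * (W * Γ * c)) := by
          rw [hy, hMm]; simp only [Matrix.mul_smul, Matrix.smul_mul, Matrix.mul_assoc]
        rw [this, Matrix.smul_mulVec, ← Matrix.mulVec_mulVec, hA, Matrix.mulVec_zero, smul_zero]
      have hau : a *ᵥ u = 0 := by rwa [Matrix.add_mulVec, hB, add_zero] at hu
      -- Step C: `u = f̃ u`, then `W u = 0`, then `u = 0`
      have hC1 : Matrix.diagonal D *ᵥ (βi *ᵥ u) = 0 := by
        rw [Matrix.mulVec_mulVec, ← hαa, ← Matrix.mulVec_mulVec, hau, Matrix.mulVec_zero]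
      have hC2 : f *ᵥ (βi *ᵥ u) = βi *ᵥ u := by
        funext i
        have hi := congrFun hC1 i
        rw [Matrix.mulVec_diagonal, Pi.zero_apply] at hi
        rw [hf, Matrix.mulVec_diagonal]
        by_cases hDi : D i = 0
        · simp [hχ, hDi]
        · have : (βi *ᵥ u) i = 0 := (mul_eq_zero.1 hi).resolve_left hDi
          simp [hχ, hDi, this]
      have hC3 : ft *ᵥ u = u := by
        rw [hft, ← Matrix.mulVec_mulVec, ← Matrix.mulVec_mulVec, hC2, Matrix.mulVec_mulVec, hβi,
          Matrix.mul_nonsing_inv β hβd, Matrix.one_mulVec]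
      have hC4 : (W * Γ * c) *ᵥ u = W *ᵥ u := by
        calc (W * Γ * c) *ᵥ u = (W * Γ * c) *ᵥ (ft *ᵥ u) := by rw [hC3]
          _ = (W * (Γ * (c * ft))) *ᵥ u := by simp only [Matrix.mulVec_mulVec, Matrix.mul_assoc]
          _ = W *ᵥ u := by rw [← hN, hΓ, ← Matrix.mulVec_mulVec, hC3]
      have hWu : ((βi.map σ)ᵀ * βi) *ᵥ u = 0 := by
        rw [hC4, hW, ← Matrix.mulVec_mulVec, ← Matrix.mulVec_mulVec, hC2, Matrix.mulVec_mulVec] at hA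
        exact hA
      have hunit : IsUnit ((βi.map σ)ᵀ * βi) := by
        refine IsUnit.mul ((Matrix.isUnit_iff_isUnit_det _).2 ?_) ((Matrix.isUnit_iff_isUnit_det _).2 hβid)
        rw [Matrix.det_transpose, ← RingHom.mapMatrix_apply, ← RingHom.map_det]
        exact hβid.map σ
      exact Matrix.mulVec_injective_iff_isUnit.2 hunit (hWu.trans (Matrix.mulVec_zero _).symm)
    refine Matrix.mulVec_injective_iff_isUnit.1 fun u v huv => ?_
    have := key (u - v) (by rw [Matrix.mulVec_sub, huv, sub_self])
    exact sub_eq_zero.1 this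

end Literature.NumberTheory.Automorphic.DoubledUnitary

end
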